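import Summits.CriticalPhenomena.PercolationContinuityZ3.Theorems.PercNearOneGluingNoHeavyPcintAdaptiveDomination
import HarnessLib

/-!
# PCINT lane, king route, K1 tools: marginals of the product weight on a set of examined sites

Cell `prim-pcint`, seat `prim-pcint-1` (gen 9); memo `run/shared/lean/prim/pcint/KING-ROUTE.md` §K1 (3).

For the Markov decomposition (K1 step (3)) the `π_q`-expectation of a step test function `g` (blind to the
coordinates outside the examined set `S`) must be written as a finite sum over the `2^{|S|}` outcome patterns on
`S`, with the product weights `∏_{v ∈ S} bern q (x v)`:

* `AdaptDom.sum_wt_filter_agree` — `Σ_{ω : ω = x on S} π_q(ω) = ∏_{v ∈ S} bern q (x v)`;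
* `AdaptDom.slice`, `AdaptDom.sum_wt_mul_eq_sum_slice` — for `h` blind outside `S`,
  `Σ_ω π_q(ω) h(ω) = Σ_{x ∈ slice S x₀} (∏_{v ∈ S} bern q (x v)) · h x`, the slice being the configurations equal
  to a fixed `x₀` off `S` (canonical representatives of the outcome patterns on `S`).
-/

namespace Summit.CriticalPhenomena.PercolationContinuityZ3.Theorems.Pcint

namespace AdaptDom

open Finset

variable {V : Type*} [Fintype V] [DecidableEq V]

/-- **Marginal of the product weight**: the configurations agreeing with `x` on `S` have total weight
`∏_{v ∈ S} bern q (x v)`. -/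
theorem sum_wt_filter_agree (q : ℝ) (S : Finset V) (x : V → Bool) :
    ∑ ω ∈ univ.filter (fun ω : V → Bool => ∀ v ∈ S, ω v = x v), wt q ω = ∏ v ∈ S, bern q (x v) := by
  classical
  -- the agreeing configurations form the box `piFinset t`, `t v = {x v}` on `S` and `univ` off `S`
  let t : V → Finset Bool := fun v => if v ∈ S then {x v} else univ
  have hset : univ.filter (fun ω : V → Bool => ∀ v ∈ S, ω v = x v) = Fintype.piFinset t := by
    ext ω
    simp only [mem_filter, mem_univ, true_and, Fintype.mem_piFinset, t]
    constructor
    · intro h v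
      by_cases hv : v ∈ S
      · rw [if_pos hv, mem_singleton]; exact h v hv
      · rw [if_neg hv]; exact mem_univ _
    · intro h v hv
      have := h v; rw [if_pos hv, mem_singleton] at this; exact this
  rw [hset]
  unfold wt
  rw [← Finset.prod_univ_sum t fun v b => bern q b]
  -- `∏_v Σ_{b ∈ t v} bern q b = ∏_{v ∈ S} bern q (x v) · ∏_{v ∉ S} 1`
  rw [← Finset.prod_filter_mul_prod_filter_not univ (· ∈ S)]
  have h1 : ∏ v ∈ univ.filter (· ∈ S), ∑ b ∈ t v, bern q b = ∏ v ∈ S, bern q (x v) := by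
    have hf : univ.filter (· ∈ S) = S := by ext v; simp
    rw [hf]
    refine Finset.prod_congr rfl fun v hv => ?_
    simp only [t, if_pos hv, sum_singleton]
  have h2 : ∏ v ∈ univ.filter (fun v => ¬ v ∈ S), ∑ b ∈ t v, bern q b = 1 := by
    refine Finset.prod_eq_one fun v hv => ?_
    have hvS : v ∉ S := (mem_filter.1 hv).2
    simp only [t, if_neg hvS]
    exact sum_bern q
  rw [h1, h2, mul_one]

/-- The configurations equal to `x₀` off `S`: canonical representatives of the outcome patterns on `S`. -/
def slice (S : Finset V) (x₀ : V → Bool) : Finset (V → Bool) := univ.filter fun x => ∀ v, v ∉ S → x v = x₀ v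

omit [Fintype V] in
/-- `mix S ω x₀` agrees with `x ∈ slice S x₀` iff `ω` agrees with `x` on `S`. -/
theorem mix_eq_iff_of_mem_slice {S : Finset V} {x₀ x : V → Bool} (hx : ∀ v, v ∉ S → x v = x₀ v) (ω : V → Bool) :
    mix S ω x₀ = x ↔ ∀ v ∈ S, ω v = x v := by
  constructor
  · intro h v hv
    have := congrFun h v
    simp only [mix, if_pos hv] at this
    exact this
  · intro h
    funext v
    unfold mix
    by_cases hv : v ∈ S
    · rw [if_pos hv, h v hv]
    · rw [if_neg hv, hx v hv]

omit [Fintype V] in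
/-- `mix S ω x₀` lies in the slice. -/
theorem mix_mem_slice_aux (S : Finset V) (ω x₀ : V → Bool) : ∀ v, v ∉ S → mix S ω x₀ v = x₀ v := by
  intro v hv; simp [mix, hv]

/-- **Expectation of a blind function as a sum over outcome patterns**: if `h ω = h (mix S ω x₀)` for all `ω`
(`h` reads only the coordinates in `S`), then `Σ_ω π_q(ω) h(ω) = Σ_{x ∈ slice S x₀} (∏_{v ∈ S} bern q (x v)) · h x`. -/
theorem sum_wt_mul_eq_sum_slice (q : ℝ) (S : Finset V) (x₀ : V → Bool) (h : (V → Bool) → ℝ)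
    (hh : ∀ ω, h ω = h (mix S ω x₀)) :
    ∑ ω : V → Bool, wt q ω * h ω = ∑ x ∈ slice S x₀, (∏ v ∈ S, bern q (x v)) * h x := by
  classical
  -- insert the indicator of the pattern of `ω`
  have step1 : ∀ ω : V → Bool, wt q ω * h ω =
      ∑ x ∈ slice S x₀, if mix S ω x₀ = x then wt q ω * h x else 0 := by
    intro ω
    have hmem : mix S ω x₀ ∈ slice S x₀ := mem_filter.2 ⟨mem_univ _, mix_mem_slice_aux S ω x₀⟩
    simp only [Finset.sum_ite_eq, hmem, if_true]
    rw [← hh ω]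
  rw [Finset.sum_congr rfl fun ω _ => step1 ω, Finset.sum_comm]
  refine Finset.sum_congr rfl fun x hx => ?_
  have hx' : ∀ v, v ∉ S → x v = x₀ v := (mem_filter.1 hx).2
  -- `Σ_ω [mix ω = x] wt ω h x = h x · Σ_{ω agrees with x on S} wt ω`
  have : ∑ ω : V → Bool, (if mix S ω x₀ = x then wt q ω * h x else 0) =
      (∑ ω ∈ univ.filter (fun ω : V → Bool => ∀ v ∈ S, ω v = x v), wt q ω) * h x := by
    rw [Finset.sum_mul, Finset.sum_filter]
    refine Finset.sum_congr rfl fun ω _ => ?_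
    by_cases h1 : mix S ω x₀ = x
    · rw [if_pos h1, if_pos ((mix_eq_iff_of_mem_slice hx' ω).1 h1)]
    · rw [if_neg h1, if_neg (fun h2 => h1 ((mix_eq_iff_of_mem_slice hx' ω).2 h2))]
  rw [this, sum_wt_filter_agree]

end AdaptDom

end Summit.CriticalPhenomena.PercolationContinuityZ3.Theorems.Pcint
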